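import Summits.MatrixMultiplication.MatrixMultiplication.Theorems.AbelianSTPPCensusShapeCertVQSearchP
import Summits.MatrixMultiplication.MatrixMultiplication.Theorems.AbelianSTPPCensusShapeCertVQEvalP403a

/-!
# Abelian STPP census — the budgeted vQ certificate at order 403, assembled from its path segments

Cell mm-stpp, rung F-M1; successor kernel item VQ-CERT in support of the closed crux item stmt-MatrixMultiplication-19191; seat
mm-stpp-vp-p2 (gen 1); support file (no definitions, no kernel search).  Folds the kernel-evaluated path segments of
`…ShapeCertVQEvalP403a…` into `ShapeCertVQ.checkQE 403 = true` with `pathSegQE_append` / `pathOK_of_seg` / `pathSeg_single_of_child` /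
`checkQE_of_pathOK_nil` (`…ShapeCertVQSearchP`).
WHAT THIS IS NOT: a Boolean fact; no statement about STPP families or `ω` by itself.
-/

set_option linter.dupNamespace false -- `MatrixMultiplication.MatrixMultiplication` (summit = problem, D-0017)
set_option autoImplicit false

namespace Summit.MatrixMultiplication.MatrixMultiplication.Theorems.ShapeCertVQ

/-- the node `[]` of order `403` is accepted by the budgeted search -/
theorem pok_403_r : PathOK 403 [] :=
  pathOK_of_seg (pathSegQE_append (pathSegQE_append (pathSegQE_append (pathSegQE_append ps_403_r_0 ps_403_r_93) ps_403_r_96) ps_403_r_105) ps_403_r_3895) (lt_of_lt_of_le (pathNode_pool_lt 403 []) (by norm_num)) (by norm_num)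

/-- **budgeted vQ certificate check at order `403`**, assembled from its path segments -/
theorem checkQE_403 : checkQE 403 = true := checkQE_of_pathOK_nil pok_403_r

end Summit.MatrixMultiplication.MatrixMultiplication.Theorems.ShapeCertVQ
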